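import Summits.BirchSwinnertonDyer.Rank1Residual.Additive.GoodModelInertiaDichotomy
import Summits.BirchSwinnertonDyer.Rank1Residual.Additive.GreenbergKummerTameDescent
import Summits.BirchSwinnertonDyer.Rank1Residual.GaloisImage.GreenbergKerCoprimeAscent
import Summits.BirchSwinnertonDyer.Rank1Residual.GaloisImage.GreenbergStrictOfNoInertiaInvariants
import Summits.BirchSwinnertonDyer.Rank1Residual.Additive.RamifiedOrdinaryLineUniqueModelFree
import Literature.NumberTheory.EllipticCurves.Greenberg1999.KummerImageGoodOrdinaryModel
import HarnessLib

/-!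
# The R-D identification `Greenberg = Kummer = strict` over `ℚ_∞` for the reduction line of a GOOD
# ORDINARY MODEL with a prime-to-`p` normal fixing level (mod cc-typer-2's S2) — row T-RD-E346
# file K4 (cell `b2b-bsdres`, team n1011; seat n1011-p05 gen 6)

HONEST FRAMING (cell `b2b-bsdres`, run/shared/lean/b2b/bsd-rank1-residual/, verbatim in every
file): the goal of the cell is to DELETE the COMBINATION-SHAPED residual classes of the
Birch–Swinnerton-Dyer formula for ALL analytic-rank `≤ 1` elliptic curves over `ℚ` — "full BSD
formula for every rank `≤ 1` curve in class `C`" assembled STRICTLY from published theorems — so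
that the rank-`≤ 1` remainder becomes exactly the CONSTRUCTION-SHAPED classes, which are TYPED
(missing-input `Prop`s), NOT attempted. This is not "finishing BSD". Team n1011 (X4 ∧ `p = 3`,
§I N10/N11; Route G δ-input on the `(G-ord)` rows with `e ∈ {3,4,6}`): research route; TOOL /
assembly theorems, CONDITIONAL on exactly ONE published named fact taken as a hypothesis — cc-typer-2's
typed S2 `Greenberg1999.imKummer_ge_strictCondition_goodOrdinaryModel` (Greenberg LNM 1716 Prop. 2.4
for a good model, p285955), never dropped; no definition, no named fact by this seat; nothing
booked; no label changes.

## What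

Setting of T-ROL-G F-A2/F-A3 (`E = W/ℚ` elliptic, `v ∋ p`, a GOOD MODEL `W₀ = C • E ⊗ K̄_v` over
the valuation ring of the spectral valuation of `K̄_v`, `red = red_{W₀} ∘ Φ_C`, the datum
`Lv.plus = C := E[p^∞] ∩ ker red`, the ORDINARY input `hord`), `κ` the cyclotomic `ℤ_p`-extension,
and a prime-to-`p` open NORMAL level `U ≤ Γ_ℚ` whose local elements at `v` FIX `C` (K1
`PrimeToPFixingLevel` for the explicit Kummer model of K5).

* `greenbergKer_kerSubgroup_eq_localKerOver_of_goodModel` (`p ≥ 5`, `E` bad at `v`):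
  **`Lv.greenbergKer (ker κ) = W.localKerOver p (ker κ) ℚ_v = Lv.strictKer (ker κ)`** — Greenberg's
  inertia condition, the Kummer condition and the strict condition over `ℚ_∞` coincide for the
  reduction line of the good model. Assembly (p05 GEN 4 draft `GenericRDIdentification`):
  at the level `ker κ ⊓ U`: `strict ⊆ Kummer` = S2 (`imKummer_ge_strictCondition_goodOrdinaryModel.kerSubgroup_inf`,
  hypothesis `hS2`), `Kummer ⊆ Greenberg` = K2 `localKerOver_le_greenbergKer_of_goodModel_of_level`;
  descent / ascent to `ker κ` along `p ∤ [Γ_ℚ : U]` = p05 F2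
  `TameDescent.strictKer_le_localKerOver_kerSubgroup_of_index_coprime` / p07
  `GaloisImage.localKerOver_le_greenbergKer_kerSubgroup_of_index_coprime`; `Greenberg = strict` at
  `ker κ` = p05 F3 `greenbergKer_eq_strictKer_of_forall_fixed_eq_zero` with K3
  `forall_fixed_eq_zero_of_goodModel_of_level`.
* `exists_isRamifiedOrdinaryLine_greenbergKer_eq_of_goodModel` — the `∃ L, IsRamifiedOrdinaryLine W p L ∧
  L.greenbergKer (ker κ) = W.localKerOver p (ker κ) ℚ_v` binder of cc-typer-2's adapter
  `Additive.ramifiedLineKummerEqAt_of_exists`, from a good ordinary model with a fixing level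
  (F-A3 `exists_isRamifiedOrdinaryLine_of_goodModel` pattern).
* `ramifiedLineKummerEqAt_of_forall_exists_goodModel` — **`RamifiedLineKummerEqAt W p`** (cc-typer-2's
  typed δ-input, `∀ κ ∀ v ∀ L`) for every `E/ℚ` admitting, at the place `v ∋ p`, a good ORDINARY
  model with a prime-to-`p` normal fixing level and bad reduction (`p ≥ 5`), mod `hS2` — model-free
  in `L` by cc-typer-2's uniqueness (p280951).

References: R. Greenberg, LNM 1716 (1999) §2 Props. 2.2, 2.4 (pp. 73–75), §5 p. 143
[GreenbergLNM1716]; R. Greenberg, V. Vatsal, Invent. Math. 142 (2000) §2 pp. 16, 19, 26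
[GreenbergVatsal2000]; J. Coates, LNM 1716 (1999) p. 31 (62) [CoatesLNM1716]; J.-P. Serre,
J. Tate, Ann. of Math. 88 (1968) §2 [SerreTate1968]; skeleton `cells/n1011/skel/T-RD-E346.md`
(f88cc66b311ca16d); `b2b-bsdres-n1011-p05/T-RD-E346-SCOPING.md`.
-/

noncomputable section

open scoped Classical NNReal

open WeierstrassCurve

universe u

namespace Summit.BirchSwinnertonDyer.Rank1Residual.Additive.GoodModelLine

open NumberField IsDedekindDomain Field IsDedekindDomain.HeightOneSpectrum
  Literature.NumberTheory.GaloisRepresentations Literature.NumberTheory.EllipticCurves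
  Literature.NumberTheory.EllipticCurves.GreenbergSelmer
  Literature.NumberTheory.EllipticCurves.Greenberg1999
  Literature.NumberTheory.EllipticCurves.EmertonPollackWeston2006
  Summit.BirchSwinnertonDyer.Rank1Residual.X2
  Summit.BirchSwinnertonDyer.Rank1Residual.X2.GreenbergVatsalReductionDatum
  Summit.BirchSwinnertonDyer.Rank1Residual.GaloisImage
  Summit.BirchSwinnertonDyer.Rank1Residual.Additive.TameDescent

variable (W : WeierstrassCurve ℚ) [W.IsElliptic] (p : ℕ) [hp : Fact p.Prime]
  {v : HeightOneSpectrum (𝓞 ℚ)}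
  {C : VariableChange (AlgebraicClosure (v.adicCompletion ℚ))}
  {W₀ : WeierstrassCurve (specVal v).integer}
  (hW₀ : C • (W.baseChange (v.adicCompletion ℚ)).baseChange (AlgebraicClosure (v.adicCompletion ℚ)) =
    W₀.baseChange (AlgebraicClosure (v.adicCompletion ℚ)))
  (hΔ : IsUnit W₀.Δ)
  (red : localPoints W (v.adicCompletion ℚ) →+
    (W₀.map (IsLocalRing.residue (specVal v).integer)).toAffine.Point)
  (hred : ∀ P, red P = goodReductionHom W₀ (Valuation.integer.integers (specVal v)) hΔ
    (Affine.Point.congrEquiv hW₀ (VariableChange.pointEquiv _ C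
      (Affine.Point.congrEquiv (baseChange_baseChange_adicCompletion W v).symm P))))
  (hord : ∃ P : (W₀.baseChange (AlgebraicClosure (v.adicCompletion ℚ))).toAffine.Point,
    (p : ℤ) • P = 0 ∧ goodReductionHom W₀ (Valuation.integer.integers (specVal v)) hΔ P ≠ 0)
  (Lv : LocalDatum ℚ (W.geomPrimaryTorsion p) v)
  (hLv : ∀ m, m ∈ Lv.plus ↔ red (pointsMap W (v.adicCompletion ℚ) (m : W.geomPoints)) = 0)

/-! ## §1 The identification over `ℚ_∞` for the reduction line of a good ordinary model -/

include hred hLv hord in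
/-- **`Greenberg = Kummer = strict` over `ℚ_∞` for the reduction line of a good ORDINARY model with a
prime-to-`p` normal fixing level** (`p ≥ 5`, `E` bad at `v ∋ p`, `κ` cyclotomic), CONDITIONAL on
cc-typer-2's typed S2 (`hS2`, Greenberg LNM 1716 Prop. 2.4 for a good model). At the level
`ker κ ⊓ U`: `strict ⊆ Kummer` (S2 `kerSubgroup_inf`) and `Kummer ⊆ Greenberg` (K2); prime-to-`p`
descent (p05 F2) and ascent (p07) to `ker κ`; `Greenberg = strict` at `ker κ` (p05 F3 with K3's free
element of `I_v ∩ ker κ`). [cite: GreenbergLNM1716, §2 Props. 2.2, 2.4 (pp. 73–75) and §5 p. 143]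
[cite: GreenbergVatsal2000, §2 p. 16 (L_v) and p. 26] -/
theorem greenbergKer_kerSubgroup_eq_localKerOver_of_goodModel
    (hS2 : imKummer_ge_strictCondition_goodOrdinaryModel) (hp5 : 5 ≤ p) (κ : ZpExtension ℚ p)
    (hκ : κ.IsCyclotomic) (hpv : ((p : ℕ) : 𝓞 ℚ) ∈ v.asIdeal) (hbad : ¬ W.HasGoodReductionAt v)
    (U : Subgroup (absoluteGaloisGroup ℚ)) [U.Normal] (hUo : IsOpen (U : Set (absoluteGaloisGroup ℚ)))
    (hcop : U.index.Coprime p)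
    (hUC : ∀ σ : absoluteGaloisGroup (v.adicCompletion ℚ),
      absGaloisRestrict ℚ (v.adicCompletion ℚ) σ ∈ U →
        C.map ((absoluteGaloisGroup.toAlgEquiv (v.adicCompletion ℚ) σ :
          AlgebraicClosure (v.adicCompletion ℚ) ≃ₐ[v.adicCompletion ℚ]
            AlgebraicClosure (v.adicCompletion ℚ)) :
          AlgebraicClosure (v.adicCompletion ℚ) →+* AlgebraicClosure (v.adicCompletion ℚ)) = C) :
    Lv.greenbergKer κ.kerSubgroup = W.localKerOver p κ.kerSubgroup (v.adicCompletion ℚ) ∧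
      Lv.strictKer κ.kerSubgroup = W.localKerOver p κ.kerSubgroup (v.adicCompletion ℚ) := by
  haveI : U.FiniteIndex := ⟨fun h0 ↦ hp.out.one_lt.ne' (by
    have h := hcop; rw [h0, Nat.coprime_zero_left] at h; exact h)⟩
  -- level `ker κ ⊓ U`: strict ⊆ Kummer (S2) and Kummer ⊆ Greenberg (K2)
  have hge : Lv.strictKer (κ.kerSubgroup ⊓ U) ≤
      W.localKerOver p (κ.kerSubgroup ⊓ U) (v.adicCompletion ℚ) :=
    imKummer_ge_strictCondition_goodOrdinaryModel.kerSubgroup_inf W p κ hκ v hpv (specVal v)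
      (specVal_spec v) C W₀ hW₀ hΔ red hred hord Lv hLv hS2 U (U.isClosed_of_isOpen hUo)
      (fun σ hσ ↦ hUC σ hσ)
  have hle : W.localKerOver p (κ.kerSubgroup ⊓ U) (v.adicCompletion ℚ) ≤
      Lv.greenbergKer (κ.kerSubgroup ⊓ U) :=
    localKerOver_le_greenbergKer_of_goodModel_of_level W p hW₀ hΔ red hred Lv hLv (κ.kerSubgroup ⊓ U)
      (fun σ hσ ↦ hUC σ (Subgroup.mem_inf.1 hσ).2)
  -- descent / ascent to `ker κ`
  have h1 : Lv.strictKer κ.kerSubgroup ≤ W.localKerOver p κ.kerSubgroup (v.adicCompletion ℚ) :=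
    strictKer_le_localKerOver_kerSubgroup_of_index_coprime W p Lv κ hUo hcop hge
  have h2 : W.localKerOver p κ.kerSubgroup (v.adicCompletion ℚ) ≤ Lv.greenbergKer κ.kerSubgroup :=
    localKerOver_le_greenbergKer_kerSubgroup_of_index_coprime W p Lv κ hUo hcop hle
  -- Greenberg = strict at `ker κ`
  have h3 : Lv.greenbergKer κ.kerSubgroup = Lv.strictKer κ.kerSubgroup :=
    greenbergKer_eq_strictKer_of_forall_fixed_eq_zero κ.kerSubgroup Lv
      (forall_fixed_eq_zero_of_goodModel_of_level W p hW₀ hΔ red hred hord Lv hLv hp5 κ hκ hpv hbad U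
        hUo hcop hUC)
  exact ⟨le_antisymm (h3 ▸ h1) h2, le_antisymm h1 (h3 ▸ h2)⟩

/-! ## §2 From a good ordinary model with a fixing level to the typed δ-input -/

include hW₀ hord in
omit red hred Lv hLv in
/-- **The `∃`-binder of cc-typer-2's adapter from a good ordinary model with a fixing level**:
`∃ L, IsRamifiedOrdinaryLine W p L ∧ L.greenbergKer (ker κ) = W.localKerOver p (ker κ) ℚ_v`
(`p ≥ 5`, bad reduction at `v ∋ p`, mod `hS2`). The line is `E[p^∞] ∩ ker(red_{W₀} ∘ Φ_C)` (F-A2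
`exists_localDatum_mem_iff_red_eq_zero`, F-A3 `isRamifiedOrdinaryLine_of_goodModel`).
[cite: GreenbergLNM1716, §2 Props. 2.2, 2.4 (pp. 73–75)] [cite: GreenbergVatsal2000, §2 p. 26]
[cite: EmertonPollackWeston2006, §3.1 (eq:ordes) (arXiv:math/0404484 p. 17)] -/
theorem exists_isRamifiedOrdinaryLine_greenbergKer_eq_of_goodModel
    (hS2 : imKummer_ge_strictCondition_goodOrdinaryModel) (hp5 : 5 ≤ p) (κ : ZpExtension ℚ p)
    (hκ : κ.IsCyclotomic) (hpv : ((p : ℕ) : 𝓞 ℚ) ∈ v.asIdeal) (hbad : ¬ W.HasGoodReductionAt v)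
    (U : Subgroup (absoluteGaloisGroup ℚ)) [U.Normal] (hUo : IsOpen (U : Set (absoluteGaloisGroup ℚ)))
    (hcop : U.index.Coprime p)
    (hUC : ∀ σ : absoluteGaloisGroup (v.adicCompletion ℚ),
      absGaloisRestrict ℚ (v.adicCompletion ℚ) σ ∈ U →
        C.map ((absoluteGaloisGroup.toAlgEquiv (v.adicCompletion ℚ) σ :
          AlgebraicClosure (v.adicCompletion ℚ) ≃ₐ[v.adicCompletion ℚ]
            AlgebraicClosure (v.adicCompletion ℚ)) :
          AlgebraicClosure (v.adicCompletion ℚ) →+* AlgebraicClosure (v.adicCompletion ℚ)) = C) :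
    ∃ L : LocalDatum ℚ (W.geomPrimaryTorsion p) v, IsRamifiedOrdinaryLine W p L ∧
      L.greenbergKer κ.kerSubgroup = W.localKerOver p κ.kerSubgroup (v.adicCompletion ℚ) := by
  let Φ₁ : localPoints W (v.adicCompletion ℚ) ≃+
      ((W.baseChange (v.adicCompletion ℚ)).baseChange (AlgebraicClosure (v.adicCompletion ℚ))).toAffine.Point :=
    Affine.Point.congrEquiv (baseChange_baseChange_adicCompletion W v).symm
  let Φ : localPoints W (v.adicCompletion ℚ) ≃+
      (W₀.baseChange (AlgebraicClosure (v.adicCompletion ℚ))).toAffine.Point :=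
    (Φ₁.trans (VariableChange.pointEquiv _ C)).trans (Affine.Point.congrEquiv hW₀)
  let red : localPoints W (v.adicCompletion ℚ) →+
      (W₀.map (IsLocalRing.residue (specVal v).integer)).toAffine.Point :=
    (goodReductionHom W₀ (Valuation.integer.integers (specVal v)) hΔ).comp Φ.toAddMonoidHom
  have hred : ∀ P, red P = goodReductionHom W₀ (Valuation.integer.integers (specVal v)) hΔ
      (Affine.Point.congrEquiv hW₀ (VariableChange.pointEquiv _ C
        (Affine.Point.congrEquiv (baseChange_baseChange_adicCompletion W v).symm P))) := fun _ ↦ rfl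
  obtain ⟨Lv, hLv⟩ := exists_localDatum_mem_iff_red_eq_zero W p hW₀ hΔ red hred
  exact ⟨Lv, isRamifiedOrdinaryLine_of_goodModel W p hW₀ hΔ red hred hord Lv hLv hpv hbad,
    (greenbergKer_kerSubgroup_eq_localKerOver_of_goodModel W p hW₀ hΔ red hred hord Lv hLv hS2 hp5 κ hκ
      hpv hbad U hUo hcop hUC).1⟩

omit hW₀ hord in
/-- **`RamifiedLineKummerEqAt W p` from good ordinary models with fixing levels** (`p ≥ 5`, mod
`hS2`): if at the place `v ∋ p` the curve `E = W/ℚ` has BAD reduction and admits a good ORDINARY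
model `W₀ = C • E ⊗ K̄_v` together with an open NORMAL `U ≤ Γ_ℚ`, `p ∤ [Γ_ℚ : U]`, whose local
elements fix `C`, then cc-typer-2's typed δ-input holds: for EVERY cyclotomic `κ`, EVERY `v ∋ p` and
EVERY ramified ordinary line `L`, `L.greenbergKer (ker κ) = W.localKerOver p (ker κ) ℚ_v`
(model-free in `L` by cc-typer-2's uniqueness, `Additive.ramifiedLineKummerEqAt_of_exists`).
[cite: GreenbergLNM1716, §2 Props. 2.2, 2.4 (pp. 73–75)] [cite: GreenbergVatsal2000, §2 pp. 16, 26]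
[cite: CoatesLNM1716, p. 31 (62)] -/
theorem ramifiedLineKummerEqAt_of_forall_exists_goodModel
    (hS2 : imKummer_ge_strictCondition_goodOrdinaryModel) (hp5 : 5 ≤ p)
    (h : ∀ (v : HeightOneSpectrum (𝓞 ℚ)), ((p : ℕ) : 𝓞 ℚ) ∈ v.asIdeal →
      ¬ W.HasGoodReductionAt v ∧
      ∃ (C : VariableChange (AlgebraicClosure (v.adicCompletion ℚ)))
        (W₀ : WeierstrassCurve (specVal v).integer)
        (_ : C • (W.baseChange (v.adicCompletion ℚ)).baseChange (AlgebraicClosure (v.adicCompletion ℚ)) =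
          W₀.baseChange (AlgebraicClosure (v.adicCompletion ℚ)))
        (hΔ : IsUnit W₀.Δ),
        (∃ P : (W₀.baseChange (AlgebraicClosure (v.adicCompletion ℚ))).toAffine.Point,
          (p : ℤ) • P = 0 ∧ goodReductionHom W₀ (Valuation.integer.integers (specVal v)) hΔ P ≠ 0) ∧
        ∃ U : Subgroup (absoluteGaloisGroup ℚ), U.Normal ∧ IsOpen (U : Set (absoluteGaloisGroup ℚ)) ∧
          U.index.Coprime p ∧
          ∀ σ : absoluteGaloisGroup (v.adicCompletion ℚ),
            absGaloisRestrict ℚ (v.adicCompletion ℚ) σ ∈ U →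
              C.map ((absoluteGaloisGroup.toAlgEquiv (v.adicCompletion ℚ) σ :
                AlgebraicClosure (v.adicCompletion ℚ) ≃ₐ[v.adicCompletion ℚ]
                  AlgebraicClosure (v.adicCompletion ℚ)) :
                AlgebraicClosure (v.adicCompletion ℚ) →+* AlgebraicClosure (v.adicCompletion ℚ)) = C) :
    RamifiedLineKummerEqAt W p := by
  refine ramifiedLineKummerEqAt_of_exists W p fun κ hκ v hpv ↦ ?_
  obtain ⟨hbad, C, W₀, hW₀, hΔ, hord, U, hUn, hUo, hcop, hUC⟩ := h v hpv
  haveI := hUn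
  exact exists_isRamifiedOrdinaryLine_greenbergKer_eq_of_goodModel W p hW₀ hΔ hord hS2 hp5 κ hκ hpv hbad
    U hUo hcop hUC

end Summit.BirchSwinnertonDyer.Rank1Residual.Additive.GoodModelLine

end
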